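import Summits.CriticalPhenomena.PercolationContinuityZ3.Theorems.PercNearOneGluingNoHeavyLowerTailCubicFourPointL1Step
import Mathlib.Tactic.Ring
import Mathlib.Tactic.Linarith
import Mathlib.Tactic.LinearCombination
import HarnessLib

/-!
# `NoHeavyLowerTail` (stmt-CriticalPhenomena-4575) — (L1): the pendant-`b` move at the level of EVENT MASSES (ready for the graph-level forest theorem)

Support file (prover prim-l12-p2, `--supports stmt-CriticalPhenomena-4575`).  Pure algebra over the 14 event masses `HybMasses` of
`…CubicFourPointL1Step`; two small definitions (`isoB`, `PBm`), `ring`/`linear_combination` proofs, no sorries, no named facts.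
Companion of `…CubicFourPointL1Moves` (the same identity in the 15 cells, `L1_cells_pendant_b_two_harris`).

If the terminal `b` hangs off a vertex `u` by one edge (or a pendant block) with connection probability `r`, the masses of `(a,b,c,y)` are
`mix (isoB x) x r` where `x` = masses of `(a,u,c,y)` and `isoB x` = the masses when `b` is isolated (all `b`-separations certain; they are
functions of `x.ac`, `x.gc` only).  For masses coming from a law two linear CONSISTENCY relations hold:
`(R1) ac − bc_ac − ac_gb + bc_ac_gb = β` (the event `a≁c, b~c, b~{a,y}` is the cell `a|bcy`) and `(R2) gc − bc_gc − gc_ab + bc_gc_ab = 0`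
(`c≁{a,y}, b~c, a~b` is empty).  THEN (`L1_mix_isoB`):
    `L1(mix (isoB x) x r) = r(1−r)·PBm x + r²·L1 x`,   `PBm x = (bc_ac_gb − ac·bc_gb) + (bc_gc_ab − bc_ab·gc)`
= the two Harris forms `H(D[a|c], D[b|acy]) + H(D[b|ac], D[c|ay])`; so (`L1_mix_isoB_nonneg`) the two Harris inequalities, (L1) for `x` and
`r ∈ [0,1]` give (L1) for the pendant configuration.  At graph level `x = massesW …` satisfies (R1), (R2) and the Harris inequalities (FKG for
decreasing connection events), which is the assembly step of "(L1) on every forest" (seat memo MEMO-P2-DC.md §6).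
[cite: Gladkov2024StrongFKG, Cor. 4.2 (Harris dictionary)]; [cite: GladkovZimin2024HK, §4 (one-edge decomposition)]
-/

namespace Summit.CriticalPhenomena.PercolationContinuityZ3.Theorems

namespace HybMasses

variable {R : Type*} [CommRing R]

/-- The masses of `(a,b,c,y)` when `b` is ISOLATED, as a function of the masses `x` of `(a,u,c,y)`: every separation involving `b` is certain,
`β = 0`, the rest is read off `x.ac = P(a≁c)` and `x.gc = P(c≁{a,y})`. [folklore] -/
def isoB (x : HybMasses R) : HybMasses R where
  bc := 1
  ac := x.ac
  ab := 1
  gb := 1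
  gc := x.gc
  β := 0
  bc_ac := x.ac
  bc_gb := 1
  ac_gb := x.ac
  bc_ac_gb := x.ac
  bc_gc := x.gc
  bc_ab := 1
  gc_ab := x.gc
  bc_gc_ab := x.gc

/-- **The pendant-`b` row as two Harris forms in the masses**: `PBm x = H(D[a|c], D[b|acy]) + H(D[b|ac], D[c|ay])`
`= (bc_ac_gb − ac·bc_gb) + (bc_gc_ab − bc_ab·gc)`. [folklore] -/
def PBm (x : HybMasses R) : R :=
  (x.bc_ac_gb - x.ac * x.bc_gb) + (x.bc_gc_ab - x.bc_ab * x.gc)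

/-- `L1` vanishes on the `b`-isolated masses. [folklore] -/
theorem L1_isoB (x : HybMasses R) : (isoB x).L1 = 0 := by
  simp only [isoB, L1, E3h]; ring

/-- **Pendant-`b` pencil in the masses.**  Under the two consistency relations (R1), (R2) of a law,
`L1(mix (isoB x) x r) = r(1−r)·PBm x + r²·L1 x`. [folklore] -/
theorem L1_mix_isoB (x : HybMasses R) (r : R)
    (hR1 : x.ac - x.bc_ac - x.ac_gb + x.bc_ac_gb = x.β)
    (hR2 : x.gc - x.bc_gc - x.gc_ab + x.bc_gc_ab = 0) :
    (mix (isoB x) x r).L1 = r * (1 - r) * PBm x + r ^ 2 * x.L1 := by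
  have key : (mix (isoB x) x r).L1 - (r * (1 - r) * PBm x + r ^ 2 * x.L1)
      = r * (1 - r) * ((x.ac - x.bc_ac - x.ac_gb + x.bc_ac_gb - x.β) + (x.gc - x.bc_gc - x.gc_ab + x.bc_gc_ab)) := by
    simp only [mix, isoB, L1, E3h, PBm]; ring
  have h1 : x.ac - x.bc_ac - x.ac_gb + x.bc_ac_gb - x.β = 0 := by rw [← hR1]; ring
  rw [h1, hR2] at key
  have : (mix (isoB x) x r).L1 - (r * (1 - r) * PBm x + r ^ 2 * x.L1) = 0 := by rw [key]; ring
  exact sub_eq_zero.mp this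

/-- **The pendant-`b` move from Harris, in the masses**: the Harris inequalities `ac·bc_gb ≤ bc_ac_gb` (`D[a|c]`, `D[b|acy]`) and
`bc_ab·gc ≤ bc_gc_ab` (`D[b|ac]`, `D[c|ay]`), (L1) for `x`, the consistency relations and `r ∈ [0,1]` give (L1) for the pendant configuration. [folklore] -/
theorem L1_mix_isoB_nonneg {x : HybMasses ℝ} {r : ℝ}
    (hR1 : x.ac - x.bc_ac - x.ac_gb + x.bc_ac_gb = x.β) (hR2 : x.gc - x.bc_gc - x.gc_ab + x.bc_gc_ab = 0)
    (hH1 : x.ac * x.bc_gb ≤ x.bc_ac_gb) (hH2 : x.bc_ab * x.gc ≤ x.bc_gc_ab) (hL : 0 ≤ x.L1)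
    (hr0 : 0 ≤ r) (hr1 : r ≤ 1) : 0 ≤ (mix (isoB x) x r).L1 := by
  rw [L1_mix_isoB x r hR1 hR2]
  have hPB : 0 ≤ PBm x := by unfold PBm; linarith
  have e1 : 0 ≤ r * (1 - r) * PBm x := mul_nonneg (mul_nonneg hr0 (by linarith)) hPB
  have e2 : 0 ≤ r ^ 2 * x.L1 := mul_nonneg (pow_nonneg hr0 2) hL
  linarith

end HybMasses

end Summit.CriticalPhenomena.PercolationContinuityZ3.Theorems
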